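import Mathlib.Analysis.SpecialFunctions.Trigonometric.DerivHyp
import Mathlib.Analysis.Calculus.Deriv.MeanValue
import HarnessLib

/-!
HONEST FRAMING: exact (Metropolis-corrected) sampling algorithms for lattice gauge theory; figures
of merit are autocorrelation/cost numbers at stated couplings and volumes; no continuum-physics
claim.

# AcceptanceFromMeanEnergyViolationEnvelope — THE LOWER ENVELOPE OF THE PENCIL
# `(cosh a − 1 + m)/(a + sinh a)` (`a > 0`) AT `m = b·tanh(b/2)` IS `tanh(b/2)`, TAKEN AT `a = b`: NO MEMBER OF THE
# PENCIL BEATS THE TWO-STATE RATE, SO THE ENVELOPE OF `AcceptanceFromMeanEnergyViolationSharp` IS EXACTLY THE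
# TWO-STATE CURVE OF `…TwoState` (row 22 `su3-ptbc`, GEN-10, ours; Mathlib-only real analysis)

Venture `LatticeQCDFlow` (cell pub-lqcd), topic `Exactness`; FANOUT row 22 (`su3-ptbc`).  NEW WORK of the cell over
Mathlib (`monotone_of_hasDerivAt_nonneg`, `antitoneOn_of_hasDerivWithinAt_nonpos`); nothing is cited as a fact;
no numerics; no measure theory (the two companion files carry it).

THE POINT.  `AcceptanceFromMeanEnergyViolationSharp` proves `1 − A/Z ≤ (cosh a − 1 + m)/(a + sinh a)` for every
`a > 0` (`m = ⟨ΔH⟩`), and `…TwoState` shows that the two-state flip of gap `b` has `m = b·t_b`,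
`t_b = (1 − e^{−b})/(1 + e^{−b}) = tanh(b/2)`, and rejection EXACTLY `t_b = (cosh b − 1 + b t_b)/(b + sinh b)` (the member
`a = b`).  This file closes the circle on the real line: at the mean `m = b·t_b` EVERY member of the pencil is at
least `t_b`,

  `t_b ≤ (cosh a − 1 + b·t_b)/(a + sinh a)`   for all `a > 0`, `b > 0`,

i.e. the infimum over the pencil (the envelope) is attained at `a = b` and equals the two-state rejection.  Hence
the pencil's envelope, the two-state curve `m ↦ tanh(a⋆/2)` (`a⋆ tanh(a⋆/2) = m`), and the true extremal rejection
of a volume-preserving reversible proposal with mean violation `m` are one and the same function.  Proof: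
`G(a) = cosh a − 1 − t_b sinh a − t_b (a − b)` is convex (`G″ = cosh a − t_b sinh a > 0` as `0 < t_b < 1`), with
`G(b) = 0` (half-angle identity `cosh b − 1 = t_b sinh b`) and `G′(b) = sinh b − t_b(cosh b + 1) = 0` (the other
half-angle identity), so `G ≥ 0`.

## What is proved (`t_b := (1 − e^{−b})/(1 + e^{−b})`, written out)

* §1 `halfTanh_pos`, `halfTanh_lt_one` (`b > 0 ⇒ 0 < t_b < 1`), `sinh_eq_halfTanh_mul_cosh_add_one`
  (`sinh b = t_b (cosh b + 1)`; the companion identity `cosh b − 1 = t_b sinh b` is derived inside the proof of §2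
  from `cosh² − sinh² = 1`, the companion file's lemma is not restated).
* §2 **`envelopeGap_nonneg`** — `0 ≤ cosh a − 1 − t_b sinh a − t_b (a − b)` for all real `a` and `b > 0`;
  **`halfTanh_le_coshPencil`** — `a > 0`, `b > 0 ⇒ t_b ≤ (cosh a − 1 + b t_b)/(a + sinh a)`.
* §3 `halfTanh_strictMono` (`b ↦ t_b` strictly increasing), **`twoStateMean_strictMonoOn`** (`b ↦ b·t_b` strictly
  increasing on `[0, ∞)`): the extremal rejection is an increasing function of the mean violation.

Literature grade (cell rule): elementary; NEW TYPING.  NOT CLAIMED: anything about a run.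
-/

namespace Summit.Ventures.LatticeQCDFlow.Exactness

open Real Set

/-! ## §1 The half-angle quantities -/

section HalfTanh

/-- `b > 0 ⇒ 0 < (1 − e^{−b})/(1 + e^{−b})`. [folklore] -/
theorem halfTanh_pos {b : ℝ} (hb : 0 < b) : 0 < (1 - Real.exp (-b)) / (1 + Real.exp (-b)) := by
  have h1 : Real.exp (-b) < 1 := by rw [← Real.exp_zero]; exact Real.exp_lt_exp.mpr (by linarith)
  have h2 : 0 < Real.exp (-b) := Real.exp_pos _
  exact div_pos (by linarith) (by linarith)

/-- `(1 − e^{−b})/(1 + e^{−b}) < 1`. [folklore] -/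
theorem halfTanh_lt_one (b : ℝ) : (1 - Real.exp (-b)) / (1 + Real.exp (-b)) < 1 := by
  have h2 : 0 < Real.exp (-b) := Real.exp_pos _
  rw [div_lt_one (by linarith)]
  linarith

/-- Half-angle identity `sinh b = t_b·(cosh b + 1)`, `t_b = (1 − e^{−b})/(1 + e^{−b})`. [folklore] -/
theorem sinh_eq_halfTanh_mul_cosh_add_one (b : ℝ) :
    Real.sinh b = (1 - Real.exp (-b)) / (1 + Real.exp (-b)) * (Real.cosh b + 1) := by
  rw [Real.cosh_eq, Real.sinh_eq]
  have hv : 0 < Real.exp (-b) := Real.exp_pos _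
  have huv : Real.exp b * Real.exp (-b) = 1 := by rw [← Real.exp_add, add_neg_cancel, Real.exp_zero]
  have hne : 1 + Real.exp (-b) ≠ 0 := by linarith
  field_simp
  nlinarith [huv]

end HalfTanh

/-! ## §2 The envelope is the two-state curve -/

section Envelope

/-- **`G ≥ 0`**: for every real `a` and `b > 0`, with `t = (1 − e^{−b})/(1 + e^{−b})`,
`0 ≤ cosh a − 1 − t·sinh a − t·(a − b)` (convex in `a`, vanishing to second order at `a = b`). [ours] -/
theorem envelopeGap_nonneg (a : ℝ) {b : ℝ} (hb : 0 < b) :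
    0 ≤ Real.cosh a - 1 - (1 - Real.exp (-b)) / (1 + Real.exp (-b)) * Real.sinh a
      - (1 - Real.exp (-b)) / (1 + Real.exp (-b)) * (a - b) := by
  set t := (1 - Real.exp (-b)) / (1 + Real.exp (-b)) with ht
  have ht0 : 0 < t := halfTanh_pos hb
  have ht1 : t < 1 := halfTanh_lt_one b
  set G : ℝ → ℝ := fun x => Real.cosh x - 1 - t * Real.sinh x - t * (x - b) with hG
  set G' : ℝ → ℝ := fun x => Real.sinh x - t * Real.cosh x - t with hG'
  -- derivatives
  have hGd : ∀ x, HasDerivAt G (G' x) x := by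
    intro x
    have h := (((Real.hasDerivAt_cosh x).sub_const 1).sub ((Real.hasDerivAt_sinh x).const_mul t)).sub
      (((hasDerivAt_id x).sub_const b).const_mul t)
    refine h.congr_deriv ?_
    simp only [hG']
    ring
  have hG'd : ∀ x, HasDerivAt G' (Real.cosh x - t * Real.sinh x) x := by
    intro x
    have h := ((Real.hasDerivAt_sinh x).sub ((Real.hasDerivAt_cosh x).const_mul t)).sub_const t
    refine h.congr_deriv ?_
    ring
  -- `G'' > 0`: `cosh x − t sinh x ≥ cosh x − |sinh x| > 0`
  have hG''pos : ∀ x, 0 ≤ Real.cosh x - t * Real.sinh x := by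
    intro x
    have hc : |Real.sinh x| < Real.cosh x := by
      rw [Real.cosh_eq, Real.sinh_eq, abs_lt]
      constructor <;> nlinarith [Real.exp_pos x, Real.exp_pos (-x)]
    have h1 : t * Real.sinh x ≤ |Real.sinh x| := by
      calc t * Real.sinh x ≤ |t * Real.sinh x| := le_abs_self _
        _ = t * |Real.sinh x| := by rw [abs_mul, abs_of_pos ht0]
        _ ≤ 1 * |Real.sinh x| := mul_le_mul_of_nonneg_right ht1.le (abs_nonneg _)
        _ = |Real.sinh x| := one_mul _
    linarith
  -- `G'` is monotone and vanishes at `b`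
  have hG'mono : Monotone G' := monotone_of_hasDerivAt_nonneg hG'd (fun x => hG''pos x)
  have hG'b : G' b = 0 := by
    simp only [hG']
    rw [sinh_eq_halfTanh_mul_cosh_add_one b, ← ht]
    ring
  -- hence `G` is antitone on `(−∞, b]` and monotone on `[b, ∞)`
  have hanti : AntitoneOn G (Iic b) := by
    refine antitoneOn_of_hasDerivWithinAt_nonpos (convex_Iic b)
      (fun x _ => (hGd x).continuousAt.continuousWithinAt) (fun x _ => (hGd x).hasDerivWithinAt) ?_
    intro x hx
    rw [interior_Iic] at hx
    have := hG'mono (le_of_lt hx)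
    rw [hG'b] at this
    exact this
  have hmono : MonotoneOn G (Ici b) := by
    refine monotoneOn_of_hasDerivWithinAt_nonneg (convex_Ici b)
      (fun x _ => (hGd x).continuousAt.continuousWithinAt) (fun x _ => (hGd x).hasDerivWithinAt) ?_
    intro x hx
    rw [interior_Ici] at hx
    have := hG'mono (le_of_lt hx)
    rw [hG'b] at this
    exact this
  have hGb : G b = 0 := by
    simp only [hG]
    have h := sinh_eq_halfTanh_mul_cosh_add_one b
    rw [← ht] at h
    -- `cosh b − 1 = t sinh b` follows from `sinh b = t (cosh b + 1)` and `cosh² − sinh² = 1`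
    have hcs : Real.cosh b ^ 2 - Real.sinh b ^ 2 = 1 := Real.cosh_sq_sub_sinh_sq b
    have hc1 : 0 < Real.cosh b + 1 := by linarith [Real.one_le_cosh b]
    have key : Real.cosh b - 1 = t * Real.sinh b := by
      have e : (Real.cosh b - 1) * (Real.cosh b + 1) = t * Real.sinh b * (Real.cosh b + 1) := by
        calc (Real.cosh b - 1) * (Real.cosh b + 1) = Real.sinh b ^ 2 := by nlinarith [hcs]
          _ = Real.sinh b * Real.sinh b := by ring
          _ = Real.sinh b * (t * (Real.cosh b + 1)) := by rw [← h]
          _ = t * Real.sinh b * (Real.cosh b + 1) := by ring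
      exact mul_right_cancel₀ hc1.ne' e
    linarith [key]
  have key : 0 ≤ G a := by
    rcases le_or_gt a b with hab | hab
    · have h := hanti (mem_Iic.mpr hab) (self_mem_Iic (a := b)) hab
      rw [hGb] at h
      exact h
    · have h := hmono (self_mem_Ici (a := b)) (mem_Ici.mpr hab.le) hab.le
      rw [hGb] at h
      exact h
  simpa only [hG] using key

/-- **THE ENVELOPE OF THE PENCIL IS THE TWO-STATE CURVE**: for `a > 0`, `b > 0` and `t_b = (1 − e^{−b})/(1 + e^{−b})`
(`= tanh(b/2)`): `t_b ≤ (cosh a − 1 + b·t_b)/(a + sinh a)` — at the two-state mean `m = b·t_b` no member of the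
pencil improves on the member `a = b`, whose value `t_b` the two-state flip attains. [ours] -/
theorem halfTanh_le_coshPencil {a b : ℝ} (ha : 0 < a) (hb : 0 < b) :
    (1 - Real.exp (-b)) / (1 + Real.exp (-b))
      ≤ (Real.cosh a - 1 + b * ((1 - Real.exp (-b)) / (1 + Real.exp (-b)))) / (a + Real.sinh a) := by
  have hc : 0 < a + Real.sinh a := add_pos ha (Real.sinh_pos_iff.mpr ha)
  rw [le_div_iff₀ hc]
  have h := envelopeGap_nonneg a hb
  nlinarith [h]

end Envelope

/-! ## §3 The extremal curve is monotone: larger mean violation, larger extremal rejection -/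

section Monotone

/-- `b ↦ t_b = (1 − e^{−b})/(1 + e^{−b})` (`= tanh(b/2)`) is strictly increasing on `ℝ`. [folklore] -/
theorem halfTanh_strictMono : StrictMono (fun b : ℝ => (1 - Real.exp (-b)) / (1 + Real.exp (-b))) := by
  intro b₁ b₂ h
  have hv₁ : 0 < Real.exp (-b₁) := Real.exp_pos _
  have hv₂ : 0 < Real.exp (-b₂) := Real.exp_pos _
  have hlt : Real.exp (-b₂) < Real.exp (-b₁) := Real.exp_lt_exp.mpr (by linarith)
  dsimp only
  rw [div_lt_div_iff₀ (by linarith) (by linarith)]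
  nlinarith

/-- **The two-state mean `b ↦ b·t_b` is strictly increasing on `[0, ∞)`** — so along the extremal curve the mean
violation `m = b·t_b` and the rejection `t_b` increase together: the envelope `m ↦ tanh(a⋆/2)` is an increasing
function of `m` (the floor `1 − tanh(a⋆/2)` of the acceptance decreases with `⟨ΔH⟩`). [ours] -/
theorem twoStateMean_strictMonoOn :
    StrictMonoOn (fun b : ℝ => b * ((1 - Real.exp (-b)) / (1 + Real.exp (-b)))) (Ici 0) := by
  intro b₁ hb₁ b₂ _ h
  have hb₁' : 0 ≤ b₁ := hb₁
  have ht₁ : 0 ≤ (1 - Real.exp (-b₁)) / (1 + Real.exp (-b₁)) := by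
    rcases eq_or_lt_of_le hb₁' with h0 | hpos
    · rw [← h0]; simp
    · exact (halfTanh_pos hpos).le
  have ht₂ : 0 < (1 - Real.exp (-b₂)) / (1 + Real.exp (-b₂)) := halfTanh_pos (by linarith)
  have hmono := halfTanh_strictMono h
  dsimp only at hmono ⊢
  calc b₁ * ((1 - Real.exp (-b₁)) / (1 + Real.exp (-b₁)))
      ≤ b₁ * ((1 - Real.exp (-b₂)) / (1 + Real.exp (-b₂))) := mul_le_mul_of_nonneg_left hmono.le hb₁'
    _ < b₂ * ((1 - Real.exp (-b₂)) / (1 + Real.exp (-b₂))) := mul_lt_mul_of_pos_right h ht₂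

end Monotone

end Summit.Ventures.LatticeQCDFlow.Exactness
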